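import Summits.Ventures.QEC.Census.CertInfoSetOrbitStabFast
import Summits.Ventures.QEC.Census.CertCheckParityFast
import Summits.Ventures.QEC.Census.CertBZPlaneSound
import Summits.Ventures.QEC.Census.TwoBGA.A2h_n240_k16_77e10a56_St.Cert
import HarnessLib

/-!
# `A2h_n240_k16_77e10a56_St` — checks module `ChecksA` (est 110 s) of the KERNEL-std certificate of census row `A2h_n240_k16_77e10a56` (qec-search-4 g6 orbit-stabilized lane)

structural checks (commutation via `commOKR`, witnesses, allow-lists), rank certificates, the masked profile checks `orbitProfileOKM` and plain-view RREF checks; assembled in `Census/TwoBGA/A2h_n240_k16_77e10a56_St/Distance.lean`.  Generated by `emit_stab_row.py`; do not edit by hand.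
-/

set_option autoImplicit false
set_option Elab.async false

namespace Summit.Ventures.QEC.Census.A2h_n240_k16_77e10a56_St

open Matrix Literature.InformationTheory.QuantumCodes Summit.Ventures.QEC.Census

/-- Commutation through the RREF of the first `Z` view (qec-search-4 `commOKR`). -/
theorem comm_ok : commOKR A2h_n240_k16_77e10a56_St.cert.n A2h_n240_k16_77e10a56_St.cert.HX A2h_n240_k16_77e10a56_St.cert.HZ A2h_n240_k16_77e10a56_St.svZ0.ic = true := by
  decide +kernel

/-- Commutation, both upper witnesses (weights 12/12) with non-membership witnesses, both allow-lists (`checkStructure_of_parts`). -/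
theorem checkStructure_ok : A2h_n240_k16_77e10a56_St.cert.checkStructure = true :=
  A2h_n240_k16_77e10a56_St.cert.checkStructure_of_parts (by decide) (commOK_of_comm (comm_of_commOKR comm_ok))
    (by decide +kernel) (by decide +kernel) (by decide +kernel) (by decide +kernel) (by decide +kernel) (by decide +kernel)

/-- Rank certificate of `H^X` (`r = 112`). -/
theorem rankX_ok : A2h_n240_k16_77e10a56_St.rcX.check A2h_n240_k16_77e10a56_St.cert.n A2h_n240_k16_77e10a56_St.cert.HX = true :=
  RankCert.check_of_checkQ (by decide) (by decide +kernel)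

/-- Rank certificate of `H^Z` (`r = 112`). -/
theorem rankZ_ok : A2h_n240_k16_77e10a56_St.rcZ.check A2h_n240_k16_77e10a56_St.cert.n A2h_n240_k16_77e10a56_St.cert.HZ = true :=
  RankCert.check_of_checkQ (by decide) (by decide +kernel)

/-- **The `Z`-side masked profile check** at threshold `11` (120 automorphisms; depths [5]; masks of sizes [130]). -/
theorem profZ_ok : orbitProfileOKM A2h_n240_k16_77e10a56_St.cert.n (A2h_n240_k16_77e10a56_St.cert.dZ - 1) (autPerms A2h_n240_k16_77e10a56_St.gensZ) A2h_n240_k16_77e10a56_St.wordsZ A2h_n240_k16_77e10a56_St.masksZ A2h_n240_k16_77e10a56_St.viewsZ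
    A2h_n240_k16_77e10a56_St.clsZ A2h_n240_k16_77e10a56_St.muZ = true := by
  decide +kernel

/-- **The `X`-side masked profile check** at threshold `11` (120 automorphisms; depths [5]; masks of sizes [130]). -/
theorem profX_ok : orbitProfileOKM A2h_n240_k16_77e10a56_St.cert.n (A2h_n240_k16_77e10a56_St.cert.dX - 1) (autPerms A2h_n240_k16_77e10a56_St.gensX) A2h_n240_k16_77e10a56_St.wordsX A2h_n240_k16_77e10a56_St.masksX A2h_n240_k16_77e10a56_St.viewsX
    A2h_n240_k16_77e10a56_St.clsX A2h_n240_k16_77e10a56_St.muX = true := by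
  decide +kernel

end Summit.Ventures.QEC.Census.A2h_n240_k16_77e10a56_St
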